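import Mathlib
import Summits.KontsevichZagierPeriods.Zeta5Search.Families.DualConstantTerm
import HarnessLib

/-!
# ζ(5) search — Families: CONJECTURE D, the degenerate cone — transport tables: the dual constant term vanishes iff a
# Hall condition fails

HONEST FRAMING: systematic search; no irrationality claim unless certified.  Cell `pub-zeta5`, certifier 2
(cert-2 g9, 2026-08-22).  Elementary combinatorics of the polynomial `dualSpanProd A = ∏_e (Σ_{w ∈ span e} X_w)^{A_e}`
(six finite edges of `₈π₈`, six gaps); nothing about `ζ(5)`; no conjecture node is used.

* `span6`, `edge6`, `dualSpanProd_eq_prod` — the product form over the six finite edges;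
* **`coeff_dualSpanProd_eq_zero_of_hall_fail`** — if for some set `E` of edges `Σ_{e ∈ E} A_e > Σ_{w ∈ N(E)} B_w`
  (`N(E)` = the gaps covered by `E`), then `[g^B] dualSpanProd A = 0` (every monomial has weight `≥ Σ_E A_e` on `N(E)`);
* **`coeff_dualSpanProd_pos_of_hall`** — conversely, if every Hall condition holds and `Σ A = Σ B`, then
  `[g^B] dualSpanProd A ≥ 1`: Hall's marriage theorem (Mathlib) on the blown-up bipartite graph gives a transport table,
  i.e. a factorisation of `g^B` into admissible monomials of the six factors.
Standard axioms only.
-/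

noncomputable section

open MvPolynomial Finset

namespace Summit.KontsevichZagierPeriods.Zeta5Search.Families.Cellular

namespace DualRate

/-! ## The product form -/

/-- The six finite edges of `₈π₈` as positions in `bzNum`. -/
def edge6 : Fin 6 → Fin 8 := ![0, 1, 2, 3, 6, 7]

/-- The gaps spanned by the six finite edges. -/
def span6 : Fin 6 → Finset (Fin 6) := ![{1, 2}, {1, 2, 3, 4, 5}, {2, 3, 4, 5}, {2, 3, 4}, {0, 1, 2, 3}, {0, 1, 2}]

/-- The linear form of an edge. -/
def spanPoly (e : Fin 6) : MvPolynomial (Fin 6) ℤ := ∑ w ∈ span6 e, X w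

/-- **Product form**: `dualSpanProd A = ∏_e spanPoly_e ^ {A_{edge e}}`. -/
theorem dualSpanProd_eq_prod (A : Fin 8 → ℕ) : dualSpanProd A = ∏ e : Fin 6, spanPoly e ^ A (edge6 e) := by
  rw [Fin.prod_univ_six]
  have h0 : spanPoly 0 = X 1 + X 2 := by simp [spanPoly, span6]
  have h1 : spanPoly 1 = X 1 + X 2 + X 3 + X 4 + X 5 := by simp [spanPoly, span6]; ring
  have h2 : spanPoly 2 = X 2 + X 3 + X 4 + X 5 := by simp [spanPoly, span6]; ring
  have h3 : spanPoly 3 = X 2 + X 3 + X 4 := by simp [spanPoly, span6]; ring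
  have h4 : spanPoly 4 = X 0 + X 1 + X 2 + X 3 := by simp [spanPoly, span6]; ring
  have h5 : spanPoly 5 = X 0 + X 1 + X 2 := by simp [spanPoly, span6]; ring
  rw [h0, h1, h2, h3, h4, h5]
  simp [dualSpanProd, edge6]

/-! ## Weights: failing Hall condition ⇒ vanishing coefficient -/

/-- The weight of a monomial on a set of gaps. -/
def weight (N : Finset (Fin 6)) (m : Fin 6 →₀ ℕ) : ℕ := ∑ w ∈ N, m w

/-- The weight is additive. -/
theorem weight_add (N : Finset (Fin 6)) (m m' : Fin 6 →₀ ℕ) : weight N (m + m') = weight N m + weight N m' := by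
  simp [weight, Finset.sum_add_distrib]

/-- Lower weight bounds multiply. -/
theorem weight_mul {p q : MvPolynomial (Fin 6) ℤ} {N : Finset (Fin 6)} {a b : ℕ}
    (hp : ∀ m ∈ p.support, a ≤ weight N m) (hq : ∀ m ∈ q.support, b ≤ weight N m) :
    ∀ m ∈ (p * q).support, a + b ≤ weight N m := by
  classical
  intro m hm
  obtain ⟨m₁, hm₁, m₂, hm₂, rfl⟩ := Finset.mem_add.1 (support_mul p q hm)
  rw [weight_add]
  exact Nat.add_le_add (hp m₁ hm₁) (hq m₂ hm₂)

/-- Lower weight bounds for powers. -/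
theorem weight_pow {p : MvPolynomial (Fin 6) ℤ} {N : Finset (Fin 6)} {a : ℕ} (hp : ∀ m ∈ p.support, a ≤ weight N m)
    (n : ℕ) : ∀ m ∈ (p ^ n).support, n * a ≤ weight N m := by
  induction n with
  | zero => intro m _; simp
  | succ k ih =>
    intro m hm
    rw [pow_succ] at hm
    have := weight_mul ih hp m hm
    simpa [Nat.succ_mul] using this

/-- The linear form of an edge covered by `N` has weight `≥ 1` on `N`; in general `≥ 0`. -/
theorem weight_spanPoly (e : Fin 6) (N : Finset (Fin 6)) (h : span6 e ⊆ N) :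
    ∀ m ∈ (spanPoly e).support, 1 ≤ weight N m := by
  classical
  intro m hm
  unfold spanPoly at hm
  obtain ⟨w, hw, hmw⟩ := Finset.mem_biUnion.1 (support_sum hm)
  rw [support_X, Finset.mem_singleton] at hmw
  subst hmw
  unfold weight
  have : (Finsupp.single w 1 : Fin 6 →₀ ℕ) w ≤ ∑ x ∈ N, (Finsupp.single w 1 : Fin 6 →₀ ℕ) x :=
    Finset.single_le_sum (f := fun x => (Finsupp.single w 1 : Fin 6 →₀ ℕ) x) (fun _ _ => Nat.zero_le _) (h hw)
  simpa using this

/-- **Failing Hall condition ⇒ the coefficient vanishes**: if `Σ_{e ∈ E} A_e > Σ_{w ∈ N(E)} B_w` then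
`[g^B] dualSpanProd A = 0`. -/
theorem coeff_dualSpanProd_eq_zero_of_hall_fail (A : Fin 8 → ℕ) (B : Fin 6 → ℕ) (E : Finset (Fin 6))
    (hfail : ∑ w ∈ E.biUnion span6, B w < ∑ e ∈ E, A (edge6 e)) :
    coeff (Finsupp.equivFunOnFinite.symm B) (dualSpanProd A) = 0 := by
  classical
  set N := E.biUnion span6 with hN
  -- every monomial of the product has weight `≥ Σ_{e ∈ E} A_e` on `N`
  have hfac : ∀ e : Fin 6, ∀ m ∈ (spanPoly e ^ A (edge6 e)).support,
      (if e ∈ E then A (edge6 e) else 0) ≤ weight N m := by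
    intro e m hm
    split_ifs with he
    · have hsub : span6 e ⊆ N := Finset.subset_biUnion_of_mem span6 he
      have := weight_pow (weight_spanPoly e N hsub) (A (edge6 e)) m hm
      simpa using this
    · exact Nat.zero_le _
  have hprod : ∀ (T : Finset (Fin 6)), ∀ m ∈ (∏ e ∈ T, spanPoly e ^ A (edge6 e)).support,
      ∑ e ∈ T, (if e ∈ E then A (edge6 e) else 0) ≤ weight N m := by
    intro T
    induction T using Finset.induction_on with
    | empty =>
      intro m hm; simp
    | @insert e T he ih =>
      intro m hm
      rw [Finset.prod_insert he] at hm
      rw [Finset.sum_insert he]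
      exact weight_mul (hfac e) ih m hm
  have hall := hprod Finset.univ
  rw [← dualSpanProd_eq_prod] at hall
  have hsumE : ∑ e ∈ (Finset.univ : Finset (Fin 6)), (if e ∈ E then A (edge6 e) else 0) = ∑ e ∈ E, A (edge6 e) := by
    rw [← Finset.sum_filter]; congr 1; ext e; simp
  rw [hsumE] at hall
  -- but the weight of `B` on `N` is too small
  by_contra hne
  have hmem : Finsupp.equivFunOnFinite.symm B ∈ (dualSpanProd A).support := mem_support_iff.2 hne
  have h1 := hall _ hmem
  have h2 : weight N (Finsupp.equivFunOnFinite.symm B) = ∑ w ∈ N, B w := by simp [weight]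
  rw [h2] at h1
  exact absurd (lt_of_lt_of_le hfail h1) (lt_irrefl _)

/-! ## Hall's theorem: all Hall conditions ⇒ positive coefficient -/

/-- Coefficients of `dualSpanProd`-type products are superadditive: for polynomials with non-negative coefficients
`[x^{m₁+m₂}](p q) ≥ [x^{m₁}] p · [x^{m₂}] q`. -/
theorem coeff_mul_ge {p q : MvPolynomial (Fin 6) ℤ} (hp : ∀ m, 0 ≤ coeff m p) (hq : ∀ m, 0 ≤ coeff m q)
    (m₁ m₂ : Fin 6 →₀ ℕ) : coeff m₁ p * coeff m₂ q ≤ coeff (m₁ + m₂) (p * q) := by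
  classical
  rw [coeff_mul]
  exact Finset.single_le_sum (f := fun x : (Fin 6 →₀ ℕ) × (Fin 6 →₀ ℕ) => coeff x.1 p * coeff x.2 q)
    (fun x _ => mul_nonneg (hp x.1) (hq x.2)) (a := (m₁, m₂)) (by simp)

/-- Products of polynomials with non-negative coefficients have non-negative coefficients. -/
theorem coeff_mul_nonneg' {p q : MvPolynomial (Fin 6) ℤ} (hp : ∀ m, 0 ≤ coeff m p) (hq : ∀ m, 0 ≤ coeff m q)
    (m : Fin 6 →₀ ℕ) : 0 ≤ coeff m (p * q) := by
  classical
  rw [coeff_mul]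
  exact Finset.sum_nonneg fun x _ => mul_nonneg (hp x.1) (hq x.2)

/-- The linear forms have non-negative coefficients. -/
theorem coeff_spanPoly_nonneg (e : Fin 6) (m : Fin 6 →₀ ℕ) : 0 ≤ coeff m (spanPoly e) := by
  classical
  unfold spanPoly
  rw [coeff_sum]
  exact Finset.sum_nonneg fun w _ => by rw [coeff_X]; split_ifs <;> norm_num

/-- Powers of the linear forms have non-negative coefficients. -/
theorem coeff_spanPoly_pow_nonneg (e : Fin 6) (n : ℕ) (m : Fin 6 →₀ ℕ) : 0 ≤ coeff m (spanPoly e ^ n) := by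
  induction n generalizing m with
  | zero => rw [pow_zero, coeff_one]; split_ifs <;> norm_num
  | succ k ih => rw [pow_succ]; exact coeff_mul_nonneg' ih (coeff_spanPoly_nonneg e) m

/-- A power of a linear form contains every product of its variables: for `w : Fin n → span e`,
`[x^{Σ_i e_{w_i}}] spanPoly_e ^ n ≥ 1`. -/
theorem one_le_coeff_spanPoly_pow (e : Fin 6) (n : ℕ) (w : Fin n → Fin 6) (hw : ∀ i, w i ∈ span6 e) :
    1 ≤ coeff (∑ i, Finsupp.single (w i) 1) (spanPoly e ^ n) := by
  classical
  induction n with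
  | zero => simp
  | succ k ih =>
    rw [Fin.sum_univ_castSucc, pow_succ]
    have h1 := ih (fun i => w (Fin.castSucc i)) (fun i => hw _)
    have h2 : coeff (Finsupp.single (w (Fin.last k)) 1) (spanPoly e) = 1 := by
      unfold spanPoly
      rw [coeff_sum]
      rw [Finset.sum_eq_single (w (Fin.last k))]
      · simp [coeff_X]
      · intro b _ hb; rw [coeff_X]; simp [Finsupp.single_eq_single_iff, hb]
      · intro h; exact absurd (hw (Fin.last k)) h
    calc (1 : ℤ) = 1 * 1 := by ring
      _ ≤ coeff (∑ i : Fin k, Finsupp.single (w (Fin.castSucc i)) 1) (spanPoly e ^ k) *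
          coeff (Finsupp.single (w (Fin.last k)) 1) (spanPoly e) := by simp only [h2, mul_one]; exact h1
      _ ≤ _ := coeff_mul_ge (coeff_spanPoly_pow_nonneg e k) (coeff_spanPoly_nonneg e) _ _

/-- The blown-up left vertices: `A_e` copies of each finite edge. -/
abbrev EdgeCopies (A : Fin 8 → ℕ) : Type := Σ e : Fin 6, Fin (A (edge6 e))

/-- The blown-up right vertices: `B_w` copies of each gap. -/
abbrev GapCopies (B : Fin 6 → ℕ) : Type := Σ w : Fin 6, Fin (B w)

/-- **All Hall conditions ⇒ positive coefficient.**  If `Σ_{e ∈ E} A_e ≤ Σ_{w ∈ N(E)} B_w` for every set of edges `E`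
and `Σ_e A_e = Σ_w B_w`, then `[g^B] dualSpanProd A ≥ 1`. -/
theorem coeff_dualSpanProd_pos_of_hall (A : Fin 8 → ℕ) (B : Fin 6 → ℕ)
    (hHall : ∀ E : Finset (Fin 6), ∑ e ∈ E, A (edge6 e) ≤ ∑ w ∈ E.biUnion span6, B w)
    (hsum : ∑ e : Fin 6, A (edge6 e) = ∑ w, B w) :
    1 ≤ coeff (Finsupp.equivFunOnFinite.symm B) (dualSpanProd A) := by
  classical
  -- the blown-up bipartite graph
  let t : EdgeCopies A → Finset (GapCopies B) := fun x => Finset.univ.filter fun y => y.1 ∈ span6 x.1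
  have hHall' : ∀ s : Finset (EdgeCopies A), s.card ≤ (s.biUnion t).card := by
    intro s
    set E := s.image Sigma.fst with hE
    -- `|s| ≤ Σ_{e ∈ E} A_e`
    have h1 : s.card ≤ ∑ e ∈ E, A (edge6 e) := by
      have hsub : s ⊆ E.sigma fun e => (Finset.univ : Finset (Fin (A (edge6 e)))) := by
        intro x hx
        rw [Finset.mem_sigma]
        exact ⟨Finset.mem_image_of_mem _ hx, Finset.mem_univ _⟩
      calc s.card ≤ (E.sigma fun e => (Finset.univ : Finset (Fin (A (edge6 e))))).card := Finset.card_le_card hsub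
        _ = ∑ e ∈ E, A (edge6 e) := by rw [Finset.card_sigma]; simp
    -- `s.biUnion t ⊇ copies of the gaps in N(E)`
    have h2 : (E.biUnion span6).sigma (fun w => (Finset.univ : Finset (Fin (B w)))) ⊆ s.biUnion t := by
      intro y hy
      rw [Finset.mem_sigma] at hy
      obtain ⟨e, he, hye⟩ := Finset.mem_biUnion.1 hy.1
      obtain ⟨x, hx, rfl⟩ := Finset.mem_image.1 he
      exact Finset.mem_biUnion.2 ⟨x, hx, by simp [t, hye]⟩
    have h3 : ∑ w ∈ E.biUnion span6, B w ≤ (s.biUnion t).card := by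
      calc ∑ w ∈ E.biUnion span6, B w = ((E.biUnion span6).sigma fun w => (Finset.univ : Finset (Fin (B w)))).card := by
            rw [Finset.card_sigma]; simp
        _ ≤ (s.biUnion t).card := Finset.card_le_card h2
    exact le_trans h1 (le_trans (hHall E) h3)
  obtain ⟨f, hf_inj, hf_mem⟩ := (Finset.all_card_le_biUnion_card_iff_exists_injective t).1 hHall'
  have hf_span : ∀ x : EdgeCopies A, (f x).1 ∈ span6 x.1 := fun x => by
    have := hf_mem x; simpa [t] using this
  -- `f` is a bijection (equal cardinalities)
  have hcard : Fintype.card (EdgeCopies A) = Fintype.card (GapCopies B) := by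
    simp only [EdgeCopies, GapCopies, Fintype.card_sigma, Fintype.card_fin]
    exact hsum
  have hf_bij : Function.Bijective f := (Fintype.bijective_iff_injective_and_card f).2 ⟨hf_inj, hcard⟩
  -- the rows of the table as monomials
  let τ : Fin 6 → (Fin 6 →₀ ℕ) := fun e => ∑ i : Fin (A (edge6 e)), Finsupp.single (f ⟨e, i⟩).1 1
  have hτ : ∀ e, 1 ≤ coeff (τ e) (spanPoly e ^ A (edge6 e)) := fun e =>
    one_le_coeff_spanPoly_pow e (A (edge6 e)) (fun i => (f ⟨e, i⟩).1) fun i => hf_span ⟨e, i⟩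
  -- the rows add up to `B`
  have hτsum : ∑ e, τ e = Finsupp.equivFunOnFinite.symm B := by
    have h1 : ∑ e, τ e = ∑ x : EdgeCopies A, Finsupp.single (f x).1 1 := by
      simp only [τ]
      rw [← Finset.univ_sigma_univ, Finset.sum_sigma]
    rw [h1]
    have h2 : ∑ x : EdgeCopies A, Finsupp.single (f x).1 1 = ∑ y : GapCopies B, (Finsupp.single y.1 1 : Fin 6 →₀ ℕ) :=
      Fintype.sum_bijective f hf_bij _ _ fun x => rfl
    rw [h2]
    have key : ∀ w : Fin 6, (∑ y : GapCopies B, (if y.1 = w then 1 else 0 : ℕ)) = B w := by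
      intro w
      rw [Finset.sum_boole]
      have hfil : (Finset.univ.filter fun y : GapCopies B => y.1 = w) =
          ({w} : Finset (Fin 6)).sigma fun v => (Finset.univ : Finset (Fin (B v))) := by
        ext ⟨v, j⟩; simp [Finset.mem_sigma]
      rw [hfil, Finset.card_sigma]
      simp
    ext w
    rw [Finsupp.finsetSum_apply]
    simp only [Finsupp.single_apply, Finsupp.coe_equivFunOnFinite_symm]
    exact key w
  -- superadditivity over the product
  have hprod : ∀ T : Finset (Fin 6), (∏ e ∈ T, coeff (τ e) (spanPoly e ^ A (edge6 e))) ≤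
      coeff (∑ e ∈ T, τ e) (∏ e ∈ T, spanPoly e ^ A (edge6 e)) ∧
      ∀ m, 0 ≤ coeff m (∏ e ∈ T, spanPoly e ^ A (edge6 e)) := by
    intro T
    induction T using Finset.induction_on with
    | empty => refine ⟨by simp, fun m => ?_⟩; rw [Finset.prod_empty, coeff_one]; split_ifs <;> norm_num
    | @insert e T he ih =>
      rw [Finset.prod_insert he, Finset.prod_insert he, Finset.sum_insert he]
      refine ⟨?_, fun m => coeff_mul_nonneg' (coeff_spanPoly_pow_nonneg e _) ih.2 m⟩
      calc coeff (τ e) (spanPoly e ^ A (edge6 e)) * ∏ e ∈ T, coeff (τ e) (spanPoly e ^ A (edge6 e))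
          ≤ coeff (τ e) (spanPoly e ^ A (edge6 e)) * coeff (∑ e ∈ T, τ e) (∏ e ∈ T, spanPoly e ^ A (edge6 e)) :=
            mul_le_mul_of_nonneg_left ih.1 (coeff_spanPoly_pow_nonneg e _ _)
        _ ≤ _ := coeff_mul_ge (coeff_spanPoly_pow_nonneg e _) ih.2 _ _
  have h := (hprod Finset.univ).1
  rw [hτsum, ← dualSpanProd_eq_prod] at h
  refine le_trans ?_ h
  have : ∀ e ∈ (Finset.univ : Finset (Fin 6)), 1 ≤ coeff (τ e) (spanPoly e ^ A (edge6 e)) := fun e _ => hτ e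
  calc (1 : ℤ) = ∏ e ∈ (Finset.univ : Finset (Fin 6)), (1 : ℤ) := by simp
    _ ≤ _ := Finset.prod_le_prod (fun _ _ => zero_le_one) this

end DualRate

end Summit.KontsevichZagierPeriods.Zeta5Search.Families.Cellular
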